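import Literature.AlgebraicGeometry.AbelianSchemes.AbelianSchemeBaseChangeComp
import Literature.AlgebraicGeometry.Limits.SliceBaseChange
import HarnessLib

/-!
# The fibre of an abelian scheme at `Spec φ ≫ s` is the base change along `φ` of the fibre at `s` (group structure included)

Layer `Literature/AlgebraicGeometry/AbelianSchemes`, namespace `Literature.AlgebraicGeometry.AbelianSchemes.AbelianSchemeOver`.
Definitions with bodies (isomorphisms) and theorems; no named fact, no instance, no `sorry`.

For an abelian scheme `A/S` (★ `AbelianSchemeOver`), a field-valued point `s : Spec Ω → S` and a field map `φ : Ω → Ω″`: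

* `fibreFieldChangeGrpIso` — `(A.fibre s) ×_Ω Ω″ ≅ A.fibre (Spec φ ≫ s)` as group objects over `Spec Ω″` (pullback pasting
  ★ `Limits.pullbackFacIso` lifted through `Functor.mapGrpNatIso`, the pattern of ★ `conjFibreIso`);
* **`fibreFieldChangeIso`** — the same as an isomorphism of abelian varieties over `Ω″`:
  `((A.fibre s).toAbelianVariety).baseChangeAlong φ ≅ (A.fibre (Spec φ ≫ s)).toAbelianVariety` (★ `AbelianVariety.baseChangeAlong`),
  with `fibreFieldChangeIso_hom_hom_hom_hom` (`rfl`) and the projection formula `fibreFieldChangeIso_hom_toSchemeHom_fst`.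

This is the «field change at a geometric point» used to compare the `Pic⁰` condition of a family at two geometric points over
the same scheme point ([MumfordAV1970] §8: `Pic⁰` is a geometric condition; [GortzWedhorn2020] Section (4.7): points and fibres
under base change).  Cell `hodgecm-mathlib`, road M13 N0 (0d-2), B-p21 (g12) lineage.
HC_CM is proved only modulo the 7 printed citations until rung 0 closes.

## References
* [GortzWedhorn2020] U. Görtz, T. Wedhorn, *Algebraic Geometry I*, 2nd ed. (2020), Section (4.7) (pp. 107–108), Remark 16.54.
* [MumfordAV1970] D. Mumford, *Abelian Varieties* (1970), §8 ((iv) ⇔ (i)).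
-/

universe u

open CategoryTheory CategoryTheory.Limits AlgebraicGeometry
open scoped TensorProduct

noncomputable section

-- `Scheme.Modules` / `SheafOfModules` are not reducible (as in Mathlib's `AlgebraicGeometry/Modules/Sheaf.lean`).
set_option backward.isDefEq.respectTransparency false

namespace Literature.AlgebraicGeometry.AbelianSchemes

open Literature.AlgebraicGeometry.Motives Literature.AlgebraicGeometry.AbelianVarieties
  Literature.AlgebraicGeometry.Modules Literature.AlgebraicGeometry.Limits

namespace AbelianSchemeOver

/-! ### §0 The fibre at `Spec φ ≫ s` is the base change of the fibre at `s` (group structure included) -/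

section FieldChange

variable {T : Scheme.{u}} (A : AbelianSchemeOver T) {Ω Ω'' : Type u} [Field Ω] [Field Ω''] (φ : Ω →+* Ω'')
  (s : Spec (.of Ω) ⟶ T)

/-- `Spec φ : Spec Ω″ ⟶ Spec Ω` for a ring map `φ : Ω → Ω″` (the morphism along which ★ `AbelianVariety.baseChangeAlong φ`
base-changes). [cite: GortzWedhorn2020, Section (4.7) (pp. 107–108)] -/
abbrev specAlong : Spec (.of Ω'') ⟶ Spec (.of Ω) := Spec.map (CommRingCat.ofHom φ)

/-- the group `Ω″`-scheme of the fibre at `Spec φ ≫ s` (by construction). [cite: GortzWedhorn2020, Section (4.7) and Remark 16.54] -/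
theorem toGrp_toAbelianVariety_fibre_specAlong :
    ((A.fibre (specAlong φ ≫ s)).toAbelianVariety).toGrp = (Over.pullback (specAlong φ ≫ s)).mapGrp.obj A.toGrp :=
  rfl

/-- the group `Ω″`-scheme of the base-changed fibre (by construction of ★ `baseChangeAlong`). [cite: GortzWedhorn2020, Section (4.7)] -/
theorem toGrp_baseChangeAlong_toAbelianVariety_fibre :
    (((A.fibre s).toAbelianVariety).baseChangeAlong φ).toGrp =
      ((Over.pullback s).mapGrp ⋙ (Over.pullback (specAlong φ)).mapGrp).obj A.toGrp :=
  rfl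

/-- **`(A_s) ⊗_Ω Ω″ ≅ A_{Spec φ ≫ s}` on GROUP `Ω″`-schemes** (transitivity of base change with explicit projections, ★
`Limits.pullbackFacIso`, lifted to group objects). [cite: GortzWedhorn2020, Section (4.7), Prop. 4.16 and Remark 16.54] -/
def fibreFieldChangeGrpIso :
    (((A.fibre s).toAbelianVariety).baseChangeAlong φ).toGrp ≅ ((A.fibre (specAlong φ ≫ s)).toAbelianVariety).toGrp :=
  (Functor.mapGrpCompIso.symm ≪≫
      Functor.mapGrpNatIso (pullbackFacIso s (specAlong φ) (specAlong φ ≫ s) rfl)).app A.toGrp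

/-- **the fibre at `Spec φ ≫ s` IS the base change of the fibre at `s` along `φ`**, as ABELIAN VARIETIES over `Ω″`.
[cite: GortzWedhorn2020, Section (4.7), Prop. 4.16] -/
def fibreFieldChangeIso :
    ((A.fibre s).toAbelianVariety).baseChangeAlong φ ≅ (A.fibre (specAlong φ ≫ s)).toAbelianVariety :=
  InducedCategory.isoMk (X := ((A.fibre s).toAbelianVariety).baseChangeAlong φ)
    (Y := (A.fibre (specAlong φ ≫ s)).toAbelianVariety) (A.fibreFieldChangeGrpIso φ s)

/-- its underlying `Ω″`-morphism is `Limits.pullbackFacObjIso … A.X` (by `rfl`). [cite: GortzWedhorn2020, Section (4.7), Prop. 4.16] -/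
theorem fibreFieldChangeIso_hom_hom_hom_hom :
    (A.fibreFieldChangeIso φ s).hom.hom.hom.hom = (pullbackFacObjIso s (specAlong φ) (specAlong φ ≫ s) rfl A.X).hom :=
  rfl

/-- **projection formula**: the underlying scheme morphism of `fibreFieldChangeIso` followed by `pr_A : A_{Spec φ ≫ s} → A` is
`(A_s)_{Ω″} → A_s → A`. [cite: GortzWedhorn2020, Section (4.7), Prop. 4.16] -/
@[reassoc]
theorem fibreFieldChangeIso_hom_toSchemeHom_fst :
    AbelianVariety.Hom.toSchemeHom (A.fibreFieldChangeIso φ s).hom ≫ pullback.fst A.X.hom (specAlong φ ≫ s) =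
      pullback.fst ((A.fibre s).toAbelianVariety.X.hom) (specAlong φ) ≫ pullback.fst A.X.hom s := by
  show (pullbackFacObjIso s (specAlong φ) (specAlong φ ≫ s) rfl A.X).hom.left ≫ _ = _
  exact pullbackFacObjIso_hom_left_fst s (specAlong φ) (specAlong φ ≫ s) rfl A.X


end FieldChange

end AbelianSchemeOver

end Literature.AlgebraicGeometry.AbelianSchemes

end
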